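/-
Copyright: public-audit package `pub-balaban` (b2b-balaban), seat pv09-g9. Released under Apache 2.0 like Mathlib.
-/
import Literature.MathematicalPhysics.QuantumFieldTheory.Balaban1983to89.B6LowerBound2153Torus

/-!
# B6 (2.153) on the torus — NON-VACUITY of the constrained subspace (a kernel-checked witness)

Source under audit: T. Bałaban, *Propagators and renormalization transformations for lattice gauge theories.
II*, Commun. Math. Phys. **96** (1984) 223–250 [B6], the use-site (2.152)–(2.153) p. 249 of Lemma 2.4 (2.128)
p. 245; Q₁ from (2.125) p. 245; (2.121) p. 244.  The one quotation below was read by this seat from the ×2 page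
render `run/shared/lean/pub/pub-balaban/b2b-balaban-ref1/pages/1984-cmp96-propagators-rt-II/…-p027-x2.png`
(p. 249; journal page = PDF page + 222), not from an OCR layer.

CITATION HEADER (lean-in-tree rule).  Cell `pub-balaban`, unit `b2b-balaban-pv09-g9` (surge node prover #09,
gen 9; journal claim G-B6-2153-TORUS-WITNESS, CLAIMS.log, self-assigned under the yield clause: T4-DAG v21 has
width 0 and LEMMAS.md no unclaimed row).  Siblings imported, none edited: `…B6LowerBound2153Torus` (pv09-g6/g7:
the dictionary periodic `Cfg d` ↔ vector fields on `Tor M` — `lift`, `restrict`, `lift_restrict`,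
`normSqT_lift`, `d1SqT_lift` — the carriers `torCarrier`, and (2.153) for the (1.66) form
`lowerBound2153_lattice`), and through it `…B6Lemma24Torus` (pv09-g5: `IsPeriodic`, `pbox`, `coarseSites`,
`faces`, `bondsT`, `plaqT`, `normSqT`, `d1SqT`, `q1SqT`, `torusCarrier`, `lemma24_torus`,
`lowerBound2153_torus_printed`, `q18_eq_q1_torus`), `…B6Lemma24PrintedShape` (Q₁ verbatim `q1`, `segSum`,
`contourSum`, the B5 (1.8) average `q18`), `…B6BondElimination` (`unitVec`, `treeBonds`, `contour`),
`…B6TreeGaugePoincare` (`Cfg`, `curl`), `…B6Elimination` (`block`), `…B5Bounds167Lattice` (`formDk`, `ofRealCfg`).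

## What is printed (verbatim)

* [B6] p. 249: *"Using (2.118) and (2.128) we get  ⟨B, Δ_kB⟩ ≥ (γ₀/(12d²)) L^{−d−1} ‖B‖²,  or
  Δ_k ≥ (γ₀/(12d²)) L^{−d−1}  (2.153)  on the subspace of B satisfying: QB = 0, B(Γ_{y,x}) = 0 for x ∈ B(y)."*
  — applied *"on the whole lattice T^{(k)}, or on a subset Λ ⊂ T^{(k)}"* (same page).

## Why this file exists

Every kernel node of the (2.153)-on-the-torus chain (`B6Lemma24Torus.lemma24_torus`,
`B6Lemma24Torus.lowerBound2153_torus_printed`, `B6LowerBound2153Torus.lowerBound2153_lattice`, the carriers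
`torusCarrier` / `torCarrier` consumed by `DagDischarged.torusTrees`) is a universally quantified implication over
*"the subspace of B satisfying: QB = 0, B(Γ_{y,x}) = 0 for x ∈ B(y)"* AS TYPED.  Such a node is only as
informative as that typed subspace is non-trivial: were the typed constraints (M-periodicity, the tree gauge
(2.121) on every block B(y), y ∈ T′, and (Q₁B)(c) = 0 at every coarse bond c of T) jointly satisfiable only by
B = 0 on T, every one of those theorems would hold vacuously and certify nothing about the print.  This file
closes that gap in the audit trail with an explicit witness, and records the one degenerate case.

## What this file proves (all [folklore] bookkeeping; nothing of Bałaban's is asserted)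

* §1–§3: for every dimension d with two distinct directions i₀ < i₁, every block size L ≥ 2 and every torus
  T = Z^d/(M₀Z × … × M_{d−1}Z) with 0 < M_μ, L ∣ M_μ, the explicit configuration `wit L i₀ i₁`
  (value χ_{LZ}(x_{i₁}+1) − χ_{LZ}(x_{i₁}) on the bonds ⟨x, x+e_{i₁}⟩ with x_{i₀} ∉ LZ, zero elsewhere) is
  M-periodic (`isPeriodic_wit`), vanishes on every tree bond of every block B(y), y ∈ LZ^d (`wit_treeBonds`; hence
  B(Γ_{y,x}) = 0, `contourSum_wit`), has (Q₁B)(c) = 0 at EVERY coarse bond c (`q1_wit` — each straight segment sum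
  telescopes to χ(x_{i₁}+L) − χ(x_{i₁}) = 0, `segSum_wit`) and B_c = 0 in the B5 (1.8) sense on T′ (`q18_wit`),
  while ‖wit‖²_T > 0 (`normSqT_wit_pos`: the bond ⟨(L−1)e_{i₁}+e_{i₀}, ·+e_{i₁}⟩ carries the value 1) and
  Σ_{p⊂T}|(∂₁wit)(p)|² > 0 (`d1SqT_wit_pos`: the plaquette at (L−1)e_{i₁} in the (i₀,i₁)-plane has curl 1).
* §4: consequently the hypotheses of `lemma24_torus`, `lowerBound2153_torus_printed` (and its `q18` variant) and
  the `TreeGauge ∧ q1Sq = 0` constraint of `torusCarrier L M` are met by a configuration with ‖B‖²_T > 0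
  (`exists_constrained_normSqT_pos`, `torusCarrier_wit`); at the witness, (2.128) reads
  0 < (1/(12d²))L^{−d−1}‖B‖² ≤ Σ_p|∂₁B|² (`lemma24_torus_at_wit`) and (2.153) gives a STRICTLY POSITIVE lower bound
  0 < (γ₀/(12d²))L^{−d−1}‖B‖² ≤ ⟨B, Δ_kB⟩ for every form obeying (2.118) with γ₀ > 0
  (`lowerBound2153_torus_printed_at_wit`).
* §5: the same on B5's configuration type `Tor M × Fin d → ℝ` (`witT := restrict M wit`, `lift_witT`): the
  constraint of `B6LowerBound2153Torus.torCarrier` holds at `witT ≠ 0` with normSq > 0, d1Sq > 0, q1Sq = 0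
  (`torCarrier_witT`), and the concrete (2.153) `lowerBound2153_lattice` yields 0 < ⟨witT, Δ_k witT⟩ for the third
  expression of (1.66), `B5Bounds167Lattice.formDk n M` (`formDk_witT_pos`).
* §6: the degenerate block size L = 1 (admitted by the `1 ≤ L` hypothesis of the chain): there B(y) = {y},
  (Q₁B)(⟨x, x+e_μ⟩) = B(⟨x, x+e_μ⟩) (`q1_one`), T′ = T (`faces_one`), so *"QB = 0"* alone forces B = 0 on every
  bond of T (`eq_zero_of_q1_one`, `normSqT_eq_zero_of_q1_one`) and, for periodic B, B = 0 identically
  (`eq_zero_of_q1_one_periodic`): at L = 1 the typed (2.153) nodes ARE vacuous, and L ≥ 2 in §1–§5 is sharp.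

HONEST SCOPE.  Bookkeeping about the package's own typed objects only: no statement of [B6] is asserted, used or
discharged here; the file has no cite-carrying hypothesis (`[cite: …]` tags below are LOCATORS of the printed
formulas the typed objects transcribe).  The witness says nothing about the size of the constants in (2.128) /
(2.153), only that the constrained subspace on T^{(k)} is non-zero whenever L ≥ 2 (and zero when L = 1).

Tags: [folklore] = finite bookkeeping proved here; [cite: …] = locator of the printed formula a definition or
statement refers to.
-/

namespace Literature.MathematicalPhysics.QuantumFieldTheory.Balaban1983to89.B6Lemma24TorusWitness

open Finset
open B6Elimination (mem_block)
open B6BondElimination (unitVec unitVec_apply add_unitVec_apply add_smul_unitVec_apply treeBonds mem_treeBonds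
  contour contour_subset_treeBonds)
open B6TreeGaugePoincare (Cfg curl)
open B6Lemma24PrintedShape (segSum q1 q18 contourSum)
open B6Lemma24Torus (IsPeriod IsPeriodic pbox mem_pbox coarseSites mem_coarseSites coarseSites_dvd faces mem_faces
  bondsT mem_bondsT plaqT mem_plaqT normSqT d1SqT q1SqT torusCarrier lemma24_torus lowerBound2153_torus_printed
  q18_eq_q1_torus wrap wrap_mem_pbox isPeriod_sub_wrap)
open B6LowerBound2153Torus (lift restrict lift_restrict normSqT_lift d1SqT_lift torCarrier lowerBound2153_lattice
  pos_of_neZero)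
open B5Prop11Plancherel (Tor)
open B5Bounds167Lattice (ofRealCfg formDk)

noncomputable section

variable {d : ℕ} {L : ℕ} {i₀ i₁ : Fin d}

/-! ## §1  One-dimensional ingredients: the indicator of LZ and its discrete derivative -/

/-- χ_L(t) = 1 if L ∣ t, 0 otherwise (indicator of the coarse lattice LZ ⊂ Z). [folklore] -/
def chi (L : ℕ) (t : ℤ) : ℝ := if (L : ℤ) ∣ t then 1 else 0

/-- s_L(t) = χ_L(t+1) − χ_L(t), the discrete derivative of χ_L. [folklore] -/
def sgn (L : ℕ) (t : ℤ) : ℝ := chi L (t + 1) - chi L t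

/-- χ_L is LZ-periodic. [folklore] -/
theorem chi_add_of_dvd (L : ℕ) (t : ℤ) {w : ℤ} (hw : (L : ℤ) ∣ w) : chi L (t + w) = chi L t := by
  simp only [chi, dvd_add_left hw]

/-- s_L is LZ-periodic. [folklore] -/
theorem sgn_add_of_dvd (L : ℕ) (t : ℤ) {w : ℤ} (hw : (L : ℤ) ∣ w) : sgn L (t + w) = sgn L t := by
  simp only [sgn, add_right_comm t w 1, chi_add_of_dvd L _ hw]

/-- Partial telescoping: Σ_{s<n} s_L(t+s) = χ_L(t+n) − χ_L(t). [folklore] -/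
theorem sum_sgn_range (L : ℕ) (t : ℤ) (n : ℕ) :
    ∑ s ∈ range n, sgn L (t + (s : ℤ)) = chi L (t + (n : ℤ)) - chi L t := by
  induction n with
  | zero => simp
  | succ n ih =>
      rw [sum_range_succ, ih]
      simp only [sgn, Nat.cast_succ, ← add_assoc]
      ring

/-- **Telescoping over one block edge**: Σ_{s<L} s_L(t+s) = χ_L(t+L) − χ_L(t) = 0. [folklore] -/
theorem sum_sgn (L : ℕ) (t : ℤ) : ∑ s ∈ range L, sgn L (t + (s : ℤ)) = 0 := by
  rw [sum_sgn_range, chi_add_of_dvd L t (dvd_refl _), sub_self]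

/-- χ_L(L) = 1. [folklore] -/
theorem chi_self (L : ℕ) : chi L (L : ℤ) = 1 := by simp [chi]

/-- For L ≥ 2, L ∤ 1. [folklore] -/
theorem not_dvd_one (hL : 2 ≤ L) : ¬ (L : ℤ) ∣ 1 := by
  rw [Int.dvd_iff_emod_eq_zero, Int.emod_eq_of_lt (by omega) (by omega)]
  omega

/-- For L ≥ 2, L ∤ L − 1, so χ_L(L−1) = 0. [folklore] -/
theorem chi_pred (hL : 2 ≤ L) : chi L ((L : ℤ) - 1) = 0 := by
  have h : ¬ (L : ℤ) ∣ (L : ℤ) - 1 := by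
    rw [Int.dvd_iff_emod_eq_zero, Int.emod_eq_of_lt (by omega) (by omega)]
    omega
  simp [chi, h]

/-- For L ≥ 2, s_L(L−1) = χ_L(L) − χ_L(L−1) = 1. [folklore] -/
theorem sgn_pred (hL : 2 ≤ L) : sgn L ((L : ℤ) - 1) = 1 := by
  rw [sgn, sub_add_cancel, chi_self, chi_pred hL, sub_zero]

/-! ## §2  The witness configuration and the constraints it satisfies -/

/-- **The witness.**  `wit L i₀ i₁ (x, ν)` = s_L(x_{i₁}) if ν = i₁ and x_{i₀} ∉ LZ, and 0 otherwise: a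
configuration on Z^d supported on the i₁-bonds starting off the coarse hyperplanes {x_{i₀} ∈ LZ}. [folklore] -/
def wit (L : ℕ) (i₀ i₁ : Fin d) : Cfg d := fun b =>
  if b.2 = i₁ ∧ ¬ (L : ℤ) ∣ b.1 i₀ then sgn L (b.1 i₁) else 0

/-- Evaluation of the witness. [folklore] -/
theorem wit_apply (b : (Fin d → ℤ) × Fin d) :
    wit L i₀ i₁ b = if b.2 = i₁ ∧ ¬ (L : ℤ) ∣ b.1 i₀ then sgn L (b.1 i₁) else 0 := rfl

/-- The witness vanishes on bonds of direction ≠ i₁. [folklore] -/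
theorem wit_of_ne {x : Fin d → ℤ} {ν : Fin d} (h : ν ≠ i₁) : wit L i₀ i₁ (x, ν) = 0 := by
  simp [wit_apply, h]

/-- The witness vanishes on bonds starting on a coarse hyperplane x_{i₀} ∈ LZ. [folklore] -/
theorem wit_of_dvd {x : Fin d → ℤ} {ν : Fin d} (h : (L : ℤ) ∣ x i₀) : wit L i₀ i₁ (x, ν) = 0 := by
  simp [wit_apply, h]

/-- **M-periodicity** (`B6Lemma24Torus.IsPeriodic`): the witness is a configuration on every torus T whose periods
are multiples of L. [folklore] -/
theorem isPeriodic_wit {M : Fin d → ℕ} (hLM : ∀ i, L ∣ M i) : IsPeriodic M (wit L i₀ i₁) := by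
  intro x v ν hv
  have hv' : ∀ i, (L : ℤ) ∣ v i := fun i => (Int.natCast_dvd_natCast.2 (hLM i)).trans (hv i)
  simp only [wit_apply, Pi.add_apply, dvd_add_left (hv' i₀), sgn_add_of_dvd L (x i₁) (hv' i₁)]

/-- **(2.121), bond-wise (tree) form**: the witness vanishes on every bond of the axial tree of every block B(y)
with y ∈ LZ^d (`B6BondElimination.treeBonds`) — a tree bond of direction i₁ has x_{i₀} = y_{i₀} ∈ LZ because
i₀ < i₁. [cite: Balaban1984PropagatorsII, (2.121) p.244 (locator; typed `treeBonds`)] -/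
theorem wit_treeBonds (h01 : i₀ < i₁) {y : Fin d → ℤ} (hy : ∀ i, (L : ℤ) ∣ y i) :
    ∀ b ∈ treeBonds L y, wit L i₀ i₁ b = 0 := by
  intro b hb
  obtain ⟨-, h1, -⟩ := mem_treeBonds.1 hb
  by_cases hν : b.2 = i₁
  · have hlt : i₀ < b.2 := by rw [hν]; exact h01
    have hdv : (L : ℤ) ∣ b.1 i₀ := by rw [h1 i₀ hlt]; exact hy i₀
    simp [wit_apply, hdv]
  · simp [wit_apply, hν]

/-- **(2.121), printed contour form**: B(Γ_{y,x}) = 0 for x ∈ B(y), y ∈ LZ^d (`B6Lemma24PrintedShape.contourSum`).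
[cite: Balaban1984PropagatorsII, (2.121) p.244, (2.153) p.249 (locator)] -/
theorem contourSum_wit (h01 : i₀ < i₁) {y : Fin d → ℤ} (hy : ∀ i, (L : ℤ) ∣ y i) {x : Fin d → ℤ}
    (hx : x ∈ B6Elimination.block L y) : contourSum L (wit L i₀ i₁) y x = 0 := by
  unfold contourSum
  exact sum_eq_zero fun b hb => wit_treeBonds h01 hy b (contour_subset_treeBonds hx hb)

/-- **Every straight segment sum of length L vanishes**: Σ_{s<L} wit(⟨x+se_μ, x+(s+1)e_μ⟩) = 0 for every x and μ
(for μ = i₁ off the coarse hyperplanes it telescopes to χ_L(x_{i₁}+L) − χ_L(x_{i₁}) = 0; otherwise every term is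
0). [folklore] -/
theorem segSum_wit (h01 : i₀ ≠ i₁) (x : Fin d → ℤ) (μ : Fin d) : segSum L (wit L i₀ i₁) x μ = 0 := by
  unfold segSum
  by_cases hμ : μ = i₁
  · rw [hμ]
    by_cases hx : (L : ℤ) ∣ x i₀
    · refine sum_eq_zero fun s _ => wit_of_dvd ?_
      rw [add_smul_unitVec_apply, if_neg h01, add_zero]
      exact hx
    · have e : ∀ s : ℕ, wit L i₀ i₁ (x + (s : ℤ) • unitVec i₁, i₁) = sgn L (x i₁ + (s : ℤ)) := by
        intro s
        have h0 : (x + (s : ℤ) • unitVec i₁) i₀ = x i₀ := by rw [add_smul_unitVec_apply, if_neg h01, add_zero]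
        have h1 : (x + (s : ℤ) • unitVec i₁) i₁ = x i₁ + (s : ℤ) := by rw [add_smul_unitVec_apply, if_pos rfl]
        show (if i₁ = i₁ ∧ ¬ (L : ℤ) ∣ (x + (s : ℤ) • unitVec i₁) i₀ then sgn L ((x + (s : ℤ) • unitVec i₁) i₁)
          else 0) = _
        rw [h0, h1, if_pos ⟨rfl, hx⟩]
      simp only [e, sum_sgn]
  · exact sum_eq_zero fun s _ => by simp [wit_apply, hμ]

/-- **QB = 0 verbatim**: (Q₁ wit)(c) = 0 at EVERY coarse bond c (`B6Lemma24PrintedShape.q1`, (2.125) verbatim).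
[cite: Balaban1984PropagatorsII, (2.125) p.245, (2.153) p.249 (locator; typed `q1`)] -/
theorem q1_wit (h01 : i₀ ≠ i₁) (c : (Fin d → ℤ) × Fin d) : q1 L (wit L i₀ i₁) c = 0 := by
  unfold q1
  exact sum_eq_zero fun x _ => by rw [segSum_wit h01, mul_zero]

/-- Hence Σ_{c∈T′}|(Q₁ wit)(c)|² = 0 on every torus (`B6Lemma24Torus.q1SqT`). [folklore] -/
theorem q1SqT_wit (h01 : i₀ ≠ i₁) (M : Fin d → ℕ) : q1SqT L M (wit L i₀ i₁) = 0 := by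
  simp [q1SqT, q1_wit h01]

/-- … and B_c = 0 in the B5 (1.8) sense at every coarse bond of T (`B6Lemma24PrintedShape.q18`, through
`B6Lemma24Torus.q18_eq_q1_torus`). [cite: Balaban1984PropagatorsI, (1.8) p.19 (locator; typed `q18`)] -/
theorem q18_wit (h01 : i₀ < i₁) {M : Fin d → ℕ} (hM : ∀ i, 0 < M i) (hLM : ∀ i, L ∣ M i)
    {c : (Fin d → ℤ) × Fin d} (hc : c ∈ faces L M) : q18 L (wit L i₀ i₁) c = 0 := by
  rw [q18_eq_q1_torus hM hLM (isPeriodic_wit hLM) (fun y hy => wit_treeBonds h01 (coarseSites_dvd y hy)) hc,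
    q1_wit h01.ne]

/-! ## §3  The witness is non-zero on T: a marked bond and a marked plaquette -/

/-- The base point z = (L−1)e_{i₁} of the marked plaquette. [folklore] -/
def zW (L : ℕ) (i₁ : Fin d) : Fin d → ℤ := fun i => if i = i₁ then (L : ℤ) - 1 else 0

/-- Coordinates of z. [folklore] -/
theorem zW_apply (i : Fin d) : zW L i₁ i = if i = i₁ then (L : ℤ) - 1 else 0 := rfl

/-- (z + e_{i₀})_{i₀} = 1. [folklore] -/
theorem zW_add_unitVec_apply_i₀ (h01 : i₀ ≠ i₁) : (zW L i₁ + unitVec i₀) i₀ = 1 := by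
  rw [add_unitVec_apply, zW_apply, if_neg h01, if_pos rfl, zero_add]

/-- (z + e_{i₀})_{i₁} = L − 1. [folklore] -/
theorem zW_add_unitVec_apply_i₁ (h01 : i₀ ≠ i₁) : (zW L i₁ + unitVec i₀) i₁ = (L : ℤ) - 1 := by
  rw [add_unitVec_apply, zW_apply, if_pos rfl, if_neg (Ne.symm h01), add_zero]

/-- **The marked bond** ⟨z + e_{i₀}, z + e_{i₀} + e_{i₁}⟩ carries the value s_L(L−1) = 1 (L ≥ 2). [folklore] -/
theorem wit_marked_bond (h01 : i₀ ≠ i₁) (hL : 2 ≤ L) : wit L i₀ i₁ (zW L i₁ + unitVec i₀, i₁) = 1 := by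
  simp only [wit_apply, zW_add_unitVec_apply_i₀ h01, zW_add_unitVec_apply_i₁ h01, not_dvd_one hL,
    not_false_eq_true, and_self, if_true, sgn_pred hL]

/-- The witness vanishes on the bond ⟨z, z + e_{i₁}⟩ (z_{i₀} = 0 ∈ LZ). [folklore] -/
theorem wit_zW_i₁ (h01 : i₀ ≠ i₁) : wit L i₀ i₁ (zW L i₁, i₁) = 0 :=
  wit_of_dvd (by rw [zW_apply, if_neg h01]; exact dvd_zero _)

/-- **The marked plaquette**: (∂₁ wit) at the plaquette with base z in the (i₀, i₁)-plane
(`B6TreeGaugePoincare.curl`) equals 0 + 1 − 0 − 0 = 1. [folklore] -/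
theorem curl_wit_marked (h01 : i₀ ≠ i₁) (hL : 2 ≤ L) : curl (wit L i₀ i₁) (zW L i₁) i₀ i₁ = 1 := by
  rw [curl, wit_of_ne h01, wit_marked_bond h01 hL, wit_of_ne h01, wit_zW_i₁ h01]
  ring

/-- z lies in the box Π[0, M_μ) of a torus with 0 < M_μ, L ∣ M_μ (L ≥ 1). [folklore] -/
theorem zW_mem_pbox (hL : 1 ≤ L) {M : Fin d → ℕ} (hM : ∀ i, 0 < M i) (hLM : ∀ i, L ∣ M i) :
    zW L i₁ ∈ pbox M := by
  refine mem_pbox.2 fun i => ?_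
  have hLe : L ≤ M i := Nat.le_of_dvd (hM i) (hLM i)
  by_cases h : i = i₁
  · rw [zW_apply, if_pos h]; constructor <;> omega
  · rw [zW_apply, if_neg h]; constructor <;> [exact le_rfl; exact_mod_cast hM i]

/-- z + e_{i₀} lies in the box (needs M_{i₀} ≥ L ≥ 2). [folklore] -/
theorem zW_add_unitVec_mem_pbox (h01 : i₀ ≠ i₁) (hL : 2 ≤ L) {M : Fin d → ℕ} (hM : ∀ i, 0 < M i)
    (hLM : ∀ i, L ∣ M i) : zW L i₁ + unitVec i₀ ∈ pbox M := by
  refine mem_pbox.2 fun i => ?_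
  have hLe : L ≤ M i := Nat.le_of_dvd (hM i) (hLM i)
  rw [add_unitVec_apply, zW_apply]
  by_cases h1 : i = i₁
  · have h0 : i ≠ i₀ := fun h => h01 (h.symm.trans h1)
    rw [if_pos h1, if_neg h0]; constructor <;> omega
  · by_cases h0 : i = i₀
    · rw [if_neg h1, if_pos h0]; constructor <;> omega
    · rw [if_neg h1, if_neg h0]; constructor <;> [exact le_rfl; exact_mod_cast hM i]

/-- **‖wit‖²_T > 0** (`B6Lemma24Torus.normSqT`): the marked bond is a bond of T and carries 1. [folklore] -/
theorem normSqT_wit_pos (h01 : i₀ ≠ i₁) (hL : 2 ≤ L) {M : Fin d → ℕ} (hM : ∀ i, 0 < M i)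
    (hLM : ∀ i, L ∣ M i) : 0 < normSqT M (wit L i₀ i₁) := by
  have hb : (zW L i₁ + unitVec i₀, i₁) ∈ bondsT M := mem_bondsT.2 (zW_add_unitVec_mem_pbox h01 hL hM hLM)
  have h1 : (1 : ℝ) ≤ ∑ b ∈ bondsT M, wit L i₀ i₁ b ^ 2 := by
    have h := single_le_sum (f := fun b => wit L i₀ i₁ b ^ 2) (fun _ _ => sq_nonneg _) hb
    simpa only [wit_marked_bond h01 hL, one_pow] using h
  unfold normSqT
  linarith

/-- **Σ_{p⊂T}|(∂₁wit)(p)|² > 0** (`B6Lemma24Torus.d1SqT`): the marked plaquette is a plaquette of T and has curl 1.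
[folklore] -/
theorem d1SqT_wit_pos (h01 : i₀ < i₁) (hL : 2 ≤ L) {M : Fin d → ℕ} (hM : ∀ i, 0 < M i)
    (hLM : ∀ i, L ∣ M i) : 0 < d1SqT M (wit L i₀ i₁) := by
  have hp : (zW L i₁, i₀, i₁) ∈ plaqT M := mem_plaqT.2 ⟨zW_mem_pbox (by omega) hM hLM, h01⟩
  have h1 : (1 : ℝ) ≤ ∑ p ∈ plaqT M, curl (wit L i₀ i₁) p.1 p.2.1 p.2.2 ^ 2 := by
    have h := single_le_sum (f := fun p : (Fin d → ℤ) × Fin d × Fin d => curl (wit L i₀ i₁) p.1 p.2.1 p.2.2 ^ 2)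
      (fun _ _ => sq_nonneg _) hp
    simpa only [curl_wit_marked h01.ne hL, one_pow] using h
  unfold d1SqT
  linarith

/-! ## §4  Non-vacuity of the typed (2.128) / (2.153) nodes on the torus -/

/-- **The constrained subspace of (2.153) on T^{(k)} is non-zero.**  For every d with two directions i₀ < i₁, every
L ≥ 2 and every torus with 0 < M_μ, L ∣ M_μ, the witness is M-periodic, satisfies (2.121) in both forms on every
block B(y), y ∈ T′, has (Q₁B)(c) = 0 and B_c = 0 at every coarse bond of T, and has ‖B‖²_T > 0 and
Σ_{p⊂T}|(∂₁B)(p)|² > 0. [cite: Balaban1984PropagatorsII, (2.153) p.249 (locator: the typed hypotheses of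
`B6Lemma24Torus.lowerBound2153_torus_printed`)] -/
theorem wit_constraints (h01 : i₀ < i₁) (hL : 2 ≤ L) {M : Fin d → ℕ} (hM : ∀ i, 0 < M i) (hLM : ∀ i, L ∣ M i) :
    IsPeriodic M (wit L i₀ i₁) ∧
    (∀ y ∈ coarseSites L M, ∀ b ∈ treeBonds L y, wit L i₀ i₁ b = 0) ∧
    (∀ y ∈ coarseSites L M, ∀ x ∈ B6Elimination.block L y, contourSum L (wit L i₀ i₁) y x = 0) ∧
    (∀ c ∈ faces L M, q1 L (wit L i₀ i₁) c = 0) ∧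
    (∀ c ∈ faces L M, q18 L (wit L i₀ i₁) c = 0) ∧
    0 < normSqT M (wit L i₀ i₁) ∧ 0 < d1SqT M (wit L i₀ i₁) :=
  ⟨isPeriodic_wit hLM,
   fun y hy => wit_treeBonds h01 (coarseSites_dvd y hy),
   fun y hy _ hx => contourSum_wit h01 (coarseSites_dvd y hy) hx,
   fun c _ => q1_wit h01.ne c,
   fun _ hc => q18_wit h01 hM hLM hc,
   normSqT_wit_pos h01.ne hL hM hLM,
   d1SqT_wit_pos h01 hL hM hLM⟩

/-- The two directions used when d ≥ 2: i₀ = 0 < 1 = i₁. [folklore] -/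
theorem dir_lt (hd : 2 ≤ d) : (⟨0, by omega⟩ : Fin d) < ⟨1, by omega⟩ := Fin.mk_lt_mk.2 zero_lt_one

/-- **Existence form** (d ≥ 2, L ≥ 2, any torus with 0 < M_μ, L ∣ M_μ): there is an M-periodic configuration in
*"the subspace of B satisfying: QB = 0, B(Γ_{y,x}) = 0 for x ∈ B(y)"* AS TYPED with ‖B‖²_T > 0 (and
Σ_p|∂₁B|² > 0). [cite: Balaban1984PropagatorsII, (2.153) p.249 (locator)] -/
theorem exists_constrained_normSqT_pos (hd : 2 ≤ d) (hL : 2 ≤ L) {M : Fin d → ℕ} (hM : ∀ i, 0 < M i)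
    (hLM : ∀ i, L ∣ M i) :
    ∃ B : Cfg d, IsPeriodic M B ∧
      (∀ y ∈ coarseSites L M, ∀ b ∈ treeBonds L y, B b = 0) ∧
      (∀ y ∈ coarseSites L M, ∀ x ∈ B6Elimination.block L y, contourSum L B y x = 0) ∧
      (∀ c ∈ faces L M, q1 L B c = 0) ∧ (∀ c ∈ faces L M, q18 L B c = 0) ∧
      0 < normSqT M B ∧ 0 < d1SqT M B :=
  ⟨_, wit_constraints (dir_lt hd) hL hM hLM⟩

/-- Positivity of the (2.128)/(2.153) prefactor at the witness. [folklore] -/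
theorem prefactor_normSqT_wit_pos (h01 : i₀ < i₁) (hL : 2 ≤ L) {M : Fin d → ℕ} (hM : ∀ i, 0 < M i)
    (hLM : ∀ i, L ∣ M i) {γ : ℝ} (hγ : 0 < γ) :
    0 < γ / (12 * (d : ℝ) ^ 2) * (L : ℝ) ^ (-((d : ℝ) + 1)) * normSqT M (wit L i₀ i₁) := by
  have hd0 : (0 : ℝ) < d := by
    have : 0 < d := lt_of_le_of_lt (Nat.zero_le _) i₁.isLt
    exact_mod_cast this
  have hLr : (0 : ℝ) < L := by exact_mod_cast (show 0 < L by omega)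
  have h1 : (0 : ℝ) < (L : ℝ) ^ (-((d : ℝ) + 1)) := Real.rpow_pos_of_pos hLr _
  have h2 := normSqT_wit_pos h01.ne hL hM hLM
  positivity

/-- **(2.128) on T at the witness is a non-trivial inequality**: 0 < (1/(12d²))L^{−d−1}‖wit‖²_T ≤ Σ_{p⊂T}|∂₁wit|²,
the Q₁-term being 0 (`B6Lemma24Torus.lemma24_torus` BY NAME). [cite: Balaban1984PropagatorsII, Lemma 2.4 (2.128)
p.245 (typed torus version, instantiated)] -/
theorem lemma24_torus_at_wit (hd : 2 ≤ d) (h01 : i₀ < i₁) (hL : 2 ≤ L) {M : Fin d → ℕ} (hM : ∀ i, 0 < M i)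
    (hLM : ∀ i, L ∣ M i) :
    0 < 1 / (12 * (d : ℝ) ^ 2) * (L : ℝ) ^ (-((d : ℝ) + 1)) * normSqT M (wit L i₀ i₁) ∧
    1 / (12 * (d : ℝ) ^ 2) * (L : ℝ) ^ (-((d : ℝ) + 1)) * normSqT M (wit L i₀ i₁) ≤ d1SqT M (wit L i₀ i₁) := by
  have h := lemma24_torus hd (by omega : 1 ≤ L) hM hLM (wit L i₀ i₁) (isPeriodic_wit hLM)
    (fun y hy => wit_treeBonds h01 (coarseSites_dvd y hy))
  rw [q1SqT_wit h01.ne, mul_zero, zero_add] at h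
  exact ⟨prefactor_normSqT_wit_pos h01 hL hM hLM one_pos, h⟩

/-- **(2.153) on T at the witness is a strictly positive lower bound**: for every quadratic form on the torus
configurations obeying (2.118) with γ₀ > 0, 0 < (γ₀/(12d²))L^{−d−1}‖wit‖²_T ≤ ⟨wit, Δ_k wit⟩
(`B6Lemma24Torus.lowerBound2153_torus_printed` BY NAME, hypotheses discharged by §2–§3).
[cite: Balaban1984PropagatorsII, (2.153) p.249, (2.118) p.243 (typed torus version, instantiated)] -/
theorem lowerBound2153_torus_printed_at_wit (hd : 2 ≤ d) (h01 : i₀ < i₁) (hL : 2 ≤ L) {M : Fin d → ℕ}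
    (hM : ∀ i, 0 < M i) (hLM : ∀ i, L ∣ M i) {γ₀ : ℝ} (hγ : 0 < γ₀) (form : Cfg d → ℝ)
    (h2118 : ∀ B : Cfg d, IsPeriodic M B → γ₀ * d1SqT M B ≤ form B) :
    0 < γ₀ / (12 * (d : ℝ) ^ 2) * (L : ℝ) ^ (-((d : ℝ) + 1)) * normSqT M (wit L i₀ i₁) ∧
    γ₀ / (12 * (d : ℝ) ^ 2) * (L : ℝ) ^ (-((d : ℝ) + 1)) * normSqT M (wit L i₀ i₁) ≤ form (wit L i₀ i₁) :=
  ⟨prefactor_normSqT_wit_pos h01 hL hM hLM hγ,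
   lowerBound2153_torus_printed hd (by omega) hM hLM hγ.le form h2118 (wit L i₀ i₁) (isPeriodic_wit hLM)
     (fun y hy x hx => contourSum_wit h01 (coarseSites_dvd y hy) hx) fun c _ => q1_wit h01.ne c⟩

/-- In particular such a form is strictly positive at the witness: ⟨wit, Δ_k wit⟩ > 0. [folklore] -/
theorem form_wit_pos (hd : 2 ≤ d) (h01 : i₀ < i₁) (hL : 2 ≤ L) {M : Fin d → ℕ} (hM : ∀ i, 0 < M i)
    (hLM : ∀ i, L ∣ M i) {γ₀ : ℝ} (hγ : 0 < γ₀) (form : Cfg d → ℝ)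
    (h2118 : ∀ B : Cfg d, IsPeriodic M B → γ₀ * d1SqT M B ≤ form B) : 0 < form (wit L i₀ i₁) := by
  obtain ⟨h0, h1⟩ := lowerBound2153_torus_printed_at_wit hd h01 hL hM hLM hγ form h2118
  exact lt_of_lt_of_le h0 h1

/-- **Carrier level** (`B6Lemma24Torus.torusCarrier L M`, the tree data behind `B6.Lemma24Printed` /
`B6.LowerBound2153` on the torus): its `TreeGauge` holds at the witness, `q1Sq wit = 0`, `0 < normSq wit`,
`0 < d1Sq wit`. [folklore] -/
theorem torusCarrier_wit (h01 : i₀ < i₁) (hL : 2 ≤ L) (M : Fin d → ℕ) (hM : ∀ i, 0 < M i) (hLM : ∀ i, L ∣ M i) :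
    (torusCarrier L M).TreeGauge (wit L i₀ i₁) ∧ (torusCarrier L M).q1Sq (wit L i₀ i₁) = 0 ∧
    0 < (torusCarrier L M).normSq (wit L i₀ i₁) ∧ 0 < (torusCarrier L M).d1Sq (wit L i₀ i₁) :=
  ⟨⟨isPeriodic_wit hLM, fun y hy => wit_treeBonds h01 (coarseSites_dvd y hy)⟩, q1SqT_wit h01.ne M,
   normSqT_wit_pos h01.ne hL hM hLM, d1SqT_wit_pos h01 hL hM hLM⟩

/-! ## §5  The witness on B5's configuration type `Tor M × Fin d → ℝ` -/

section TorSide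

variable (M : Fin d → ℕ) [∀ μ, NeZero (M μ)]

/-- The witness as a real vector field on the torus `Tor M` (`B6LowerBound2153Torus.restrict`). [folklore] -/
def witT (L : ℕ) (i₀ i₁ : Fin d) : Tor M × Fin d → ℝ := restrict M (wit L i₀ i₁)

/-- Its periodic extension is the witness (`B6LowerBound2153Torus.lift_restrict`). [folklore] -/
theorem lift_witT (hLM : ∀ i, L ∣ M i) : lift M (witT M L i₀ i₁) = wit L i₀ i₁ :=
  lift_restrict M (isPeriodic_wit hLM)

/-- Σ_{t∈T} Σ_ν witT(t,ν)² = ‖wit‖²_T (`B6LowerBound2153Torus.normSqT_lift`). [folklore] -/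
theorem normSq_witT (hLM : ∀ i, L ∣ M i) :
    ∑ t : Tor M, ∑ ν, witT M L i₀ i₁ (t, ν) ^ 2 = normSqT M (wit L i₀ i₁) := by
  rw [← normSqT_lift M (witT M L i₀ i₁), lift_witT M hLM]

/-- **Carrier level on B5's type** (`B6LowerBound2153Torus.torCarrier L M`, the carriers of
`DagDischarged.torusTrees`): `TreeGauge` holds at `witT`, `q1Sq = 0`, `0 < normSq`, `0 < d1Sq` (the latter = B5's
⟨∂₁B, ∂₁B⟩ through `d1SqT_lift`). [folklore] -/
theorem torCarrier_witT (h01 : i₀ < i₁) (hL : 2 ≤ L) (hLM : ∀ i, L ∣ M i) :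
    (torCarrier L M).TreeGauge (witT M L i₀ i₁) ∧ (torCarrier L M).q1Sq (witT M L i₀ i₁) = 0 ∧
    0 < (torCarrier L M).normSq (witT M L i₀ i₁) ∧ 0 < (torCarrier L M).d1Sq (witT M L i₀ i₁) := by
  refine ⟨?_, ?_, ?_, ?_⟩
  · show ∀ y ∈ coarseSites L M, ∀ b ∈ treeBonds L y, lift M (witT M L i₀ i₁) b = 0
    rw [lift_witT M hLM]
    exact fun y hy => wit_treeBonds h01 (coarseSites_dvd y hy)
  · show q1SqT L M (lift M (witT M L i₀ i₁)) = 0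
    rw [lift_witT M hLM, q1SqT_wit h01.ne]
  · show 0 < ∑ t : Tor M, ∑ ν, witT M L i₀ i₁ (t, ν) ^ 2
    rw [normSq_witT M hLM]
    exact normSqT_wit_pos h01.ne hL (pos_of_neZero M) hLM
  · show 0 < B5Bounds167Lattice.d1Sq M (ofRealCfg M (witT M L i₀ i₁))
    rw [← d1SqT_lift M, lift_witT M hLM]
    exact d1SqT_wit_pos h01 hL (pos_of_neZero M) hLM

/-- `witT ≠ 0`. [folklore] -/
theorem witT_ne_zero (h01 : i₀ < i₁) (hL : 2 ≤ L) (hLM : ∀ i, L ∣ M i) : witT M L i₀ i₁ ≠ 0 := by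
  intro h
  have hpos := (torCarrier_witT M h01 hL hLM).2.2.1
  have hzero : (torCarrier L M).normSq (witT M L i₀ i₁) = 0 := by
    show ∑ t : Tor M, ∑ ν, witT M L i₀ i₁ (t, ν) ^ 2 = 0
    simp [h]
  rw [hzero] at hpos
  exact lt_irrefl _ hpos

/-- **(2.153) for the (1.66) form at the witness is strictly positive**: for d ≥ 2, L ≥ 2, n ≥ 1 and any torus with
NeZero periods divisible by L, 0 < ((4/π²)^{d+2}/(12d²)) L^{−d−1} Σ_{t,ν} witT² ≤ ⟨witT, Δ_k witT⟩ with Δ_k the third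
expression of (1.66) (`B5Bounds167Lattice.formDk n M`), by `B6LowerBound2153Torus.lowerBound2153_lattice` BY NAME.
[cite: Balaban1984PropagatorsII, (2.153) p.249; Balaban1984PropagatorsI, (1.66) p.29 (typed, instantiated)] -/
theorem lowerBound2153_lattice_at_witT (hd : 2 ≤ d) (h01 : i₀ < i₁) (hL : 2 ≤ L) (n : ℕ) (hn : 1 ≤ n)
    (hLM : ∀ i, L ∣ M i) :
    0 < (4 / Real.pi ^ 2) ^ (d + 2) / (12 * (d : ℝ) ^ 2) * (L : ℝ) ^ (-((d : ℝ) + 1))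
          * ∑ t : Tor M, ∑ ν, witT M L i₀ i₁ (t, ν) ^ 2 ∧
    (4 / Real.pi ^ 2) ^ (d + 2) / (12 * (d : ℝ) ^ 2) * (L : ℝ) ^ (-((d : ℝ) + 1))
          * ∑ t : Tor M, ∑ ν, witT M L i₀ i₁ (t, ν) ^ 2
      ≤ formDk n M (ofRealCfg M (witT M L i₀ i₁)) := by
  refine ⟨?_, lowerBound2153_lattice M hd (by omega) n hn hLM (witT M L i₀ i₁) ?_ ?_⟩
  · rw [normSq_witT M hLM]
    exact prefactor_normSqT_wit_pos h01 hL (pos_of_neZero M) hLM (by positivity)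
  · rw [lift_witT M hLM]
    exact fun y hy => wit_treeBonds h01 (coarseSites_dvd y hy)
  · rw [lift_witT M hLM]
    exact fun c _ => q1_wit h01.ne c

/-- Hence ⟨witT, Δ_k witT⟩ > 0 for the (1.66) form. [folklore] -/
theorem formDk_witT_pos (hd : 2 ≤ d) (h01 : i₀ < i₁) (hL : 2 ≤ L) (n : ℕ) (hn : 1 ≤ n) (hLM : ∀ i, L ∣ M i) :
    0 < formDk n M (ofRealCfg M (witT M L i₀ i₁)) := by
  obtain ⟨h0, h1⟩ := lowerBound2153_lattice_at_witT M hd h01 hL n hn hLM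
  exact lt_of_lt_of_le h0 h1

/-- **Existence form on B5's type** (d ≥ 2, L ≥ 2): a non-zero real vector field on `Tor M` in the typed constrained
subspace of `torCarrier L M`, with (Q₁(lift B))(c) = 0 at every coarse bond. [folklore] -/
theorem exists_torCarrier_ne_zero (hd : 2 ≤ d) (hL : 2 ≤ L) (hLM : ∀ i, L ∣ M i) :
    ∃ B : Tor M × Fin d → ℝ, B ≠ 0 ∧ (torCarrier L M).TreeGauge B ∧
      (∀ c ∈ faces L M, q1 L (lift M B) c = 0) ∧ (torCarrier L M).q1Sq B = 0 ∧
      0 < (torCarrier L M).normSq B ∧ 0 < (torCarrier L M).d1Sq B := by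
  obtain ⟨hT, hq, hn, hd1⟩ := torCarrier_witT M (dir_lt hd) hL hLM
  refine ⟨witT M L ⟨0, by omega⟩ ⟨1, by omega⟩, witT_ne_zero M (dir_lt hd) hL hLM, hT, ?_, hq, hn, hd1⟩
  rw [lift_witT M hLM]
  exact fun c _ => q1_wit (dir_lt hd).ne c

end TorSide

/-! ## §6  The degenerate block size L = 1: there the typed constrained subspace IS {0} -/

/-- For L = 1 the block B(y) is the single site y. [folklore] -/
theorem block_one (y : Fin d → ℤ) : B6Elimination.block 1 y = {y} := by
  ext z
  simp only [mem_block, Nat.cast_one, mem_singleton]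
  constructor
  · intro h
    funext i
    have := h i
    omega
  · rintro rfl i
    omega

/-- For L = 1, (Q₁B)(⟨x, x+e_μ⟩) = B(⟨x, x+e_μ⟩). [folklore] -/
theorem q1_one (B : Cfg d) (x : Fin d → ℤ) (μ : Fin d) : q1 1 B (x, μ) = B (x, μ) := by
  simp [q1, segSum, block_one]

/-- For L = 1, T′ = T: every bond of the torus is a coarse bond. [folklore] -/
theorem faces_one (M : Fin d → ℕ) : faces 1 M = bondsT M := by
  ext c
  simp [mem_faces, mem_coarseSites, mem_bondsT]

/-- **L = 1 collapse**: *"QB = 0"* AS TYPED at L = 1 forces B = 0 on every bond of T. [folklore] -/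
theorem eq_zero_of_q1_one {M : Fin d → ℕ} {B : Cfg d} (hQ : ∀ c ∈ faces 1 M, q1 1 B c = 0) :
    ∀ b ∈ bondsT M, B b = 0 := by
  rintro ⟨x, μ⟩ hb
  have h := hQ (x, μ) (by rwa [faces_one])
  rwa [q1_one] at h

/-- … hence ‖B‖²_T = 0: at L = 1 the lower bounds `lemma24_torus` / `lowerBound2153_torus_printed` have left side 0
for every admissible B. [folklore] -/
theorem normSqT_eq_zero_of_q1_one {M : Fin d → ℕ} {B : Cfg d} (hQ : ∀ c ∈ faces 1 M, q1 1 B c = 0) :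
    normSqT M B = 0 := by
  unfold normSqT
  exact sum_eq_zero fun b hb => by rw [eq_zero_of_q1_one hQ b hb]; ring

/-- … and a periodic such B vanishes identically on Z^d. [folklore] -/
theorem eq_zero_of_q1_one_periodic {M : Fin d → ℕ} (hM : ∀ i, 0 < M i) {B : Cfg d} (hB : IsPeriodic M B)
    (hQ : ∀ c ∈ faces 1 M, q1 1 B c = 0) : ∀ b, B b = 0 := by
  rintro ⟨x, ν⟩
  have hp := hB (wrap M x) (x - wrap M x) ν (isPeriod_sub_wrap x)
  rw [add_sub_cancel] at hp
  rw [hp]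
  exact eq_zero_of_q1_one hQ _ (mem_bondsT.2 (wrap_mem_pbox hM x))

end

end Literature.MathematicalPhysics.QuantumFieldTheory.Balaban1983to89.B6Lemma24TorusWitness
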